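import Mathlib
import Literature.Analysis.FluidPDE.StationaryEulerRelaxationHighDim
import Literature.Analysis.FluidPDE.StationaryEulerPotentials
import Literature.Analysis.FluidPDE.StationaryEulerAlignedCubes
import Literature.Analysis.FluidPDE.StationaryEulerTorusGrid
import Literature.Analysis.FluidPDE.VectorCalculus
import Summits.AnomalousDissipation.AnomalousDissipation.Theorems.PointSinkPointFluxConeBoxIterationTools
import HarnessLib

/-!
# `PointFluxCone`, line `Sketch` — small tools for the assembly of the wild box (`stub_wildBox`)

Helper file of the lead prover for item stmt-AnomalousDissipation-19033 (route PointSink, crux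
`PointFluxCone`), line `Sketch`, stub `stub_wildBox` (`ITER → WILDBOX`).  Given
* the SEED (sub-stub `stub_wildBoxSeedTools`): a smooth compactly supported divergence-free
  `v₀` in the unit box with the energy profile `e = E₀ + ⟪v₀, x + c⟫`, `c = 3e₀`, strict
  subsolution `(v₀, 0) ∈ 𝒰_e`, the signal `S₀ = ∫ ⟪v₀, g⟫ > 0` for the test field
  `g = ⟪v₀, x+c⟫ (x+c)/‖x+c‖²`, a smooth compactly supported `θ` with `∇θ = (x+c)/‖x+c‖²` on the
  box, and the pairing identity `⟪a, (b, 0)⟫ = ⟪vel a, b⟫`;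
* the LIMIT lemma (sub-stub `stub_wildBoxLimitTools`): the a.e. limit `wl` with uniform pressure
  limit `πl` of a run of the box iteration, with `wl ∈ 𝒦` a.e., `|vel wl|² = e` a.e. on the box
  and the two weak identities;
* the ITERATION (landed stub `stub_boxIteration`),
this file proves WILDBOX: `W = vel ∘ wl`, `P = πl − |W|²/3` is a bounded, compactly supported weak
Euler pair with explicit pressure, weakly divergence free, whose log-radial Bernoulli moment about
`−c` is `(1/6)·S₀ + O(θ + δ) ≠ 0` for the budgets `θ = S₀/2`, `δ = S₀/(8(R+1))`.
-/

noncomputable section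

open scoped InnerProductSpace ContDiff ENNReal Topology
open Set Function MeasureTheory Metric Filter
open Literature.Analysis.FluidPDE Literature.Analysis.FluidPDE.StationaryEuler
open Literature.Analysis.FunctionSpaces

set_option linter.dupNamespace false

namespace Summit.AnomalousDissipation.AnomalousDissipation.Theorems

/-! ## Small tools -/

/-- A bounded a.e.-strongly measurable function on `ℝ³` vanishing off the unit box is integrable
(the box has volume one). [folklore] -/
theorem wildBox_integrable_of_bdd {F : Type*} [NormedAddCommGroup F] {f : Ed (Fin 3) → F}
    (hf : AEStronglyMeasurable f volume) {C : ℝ} (hC : ∀ x, ‖f x‖ ≤ C)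
    (h0 : ∀ x, x ∉ box (Fin 3) → f x = 0) : Integrable f := by
  have hfin : volume (box (Fin 3)) ≠ ⊤ := by rw [volume_box]; exact ENNReal.one_ne_top
  exact (Measure.integrableOn_of_bounded hfin hf (Eventually.of_forall fun x => hC x)).integrable_of_forall_notMem_eq_zero h0

/-- On the unit box, `‖x + 3e₀‖ ≥ 3`. [folklore] -/
theorem wildBox_three_le_norm_add {x : Ed (Fin 3)} (hx : x ∈ box (Fin 3)) :
    3 ≤ ‖x + (3 : ℝ) • eb (0 : Fin 3)‖ := by
  have h0 := (hx 0).1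
  have h1 : (x + (3 : ℝ) • eb (0 : Fin 3)) 0 = x 0 + 3 := by
    simp [eb]
  have h2 : |(x + (3 : ℝ) • eb (0 : Fin 3)) 0| ≤ ‖x + (3 : ℝ) • eb (0 : Fin 3)‖ := by
    simpa [Real.norm_eq_abs] using PiLp.norm_apply_le (x + (3 : ℝ) • eb (0 : Fin 3)) 0
  rw [h1, abs_of_pos (by linarith)] at h2
  linarith

/-- `mkSt 0 0 = 0`. [folklore] -/
theorem wildBox_mkSt_zero : (mkSt (0 : Ed (Fin 3)) 0 : State (Fin 3)) = 0 :=
  ext_vel_str (by rw [vel_mkSt, vel_zero]) (by rw [str_mkSt, str_zero])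

/-- Components of the Fréchet derivative: `(Dφ(x) v)ᵢ = D(φᵢ)(x) v`. [folklore] -/
theorem wildBox_fderiv_apply_component {φ : Ed (Fin 3) → Ed (Fin 3)} {x : Ed (Fin 3)}
    (hφ : DifferentiableAt ℝ φ x) (v : Ed (Fin 3)) (i : Fin 3) :
    fderiv ℝ φ x v i = pd v (fun y => φ y i) x := by
  have h2 : HasFDerivAt (fun y => φ y i) ((EuclideanSpace.proj i).comp (fderiv ℝ φ x)) x :=
    (EuclideanSpace.proj (𝕜 := ℝ) i).hasFDerivAt.comp x hφ.hasFDerivAt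
  rw [pd, h2.fderiv]
  rfl

/-- `Dφ(x) v = Σⱼ vⱼ Dφ(x) eⱼ` componentwise: `(Dφ(x) v)ᵢ = Σⱼ vⱼ ∂ⱼφᵢ(x)`. [folklore] -/
theorem wildBox_fderiv_apply_eq_sum {φ : Ed (Fin 3) → Ed (Fin 3)} {x : Ed (Fin 3)}
    (hφ : DifferentiableAt ℝ φ x) (v : Ed (Fin 3)) (i : Fin 3) :
    fderiv ℝ φ x v i = ∑ j, v j * pd (eb j) (fun y => φ y i) x := by
  have hv : v = ∑ j, v j • eb j := by
    have := (EuclideanSpace.basisFun (Fin 3) ℝ).sum_repr v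
    simp only [EuclideanSpace.basisFun_repr, EuclideanSpace.basisFun_apply] at this
    exact this.symm
  conv_lhs => rw [hv]
  rw [map_sum]
  simp only [map_smul, WithLp.ofLp_sum, WithLp.ofLp_smul, Finset.sum_apply, Pi.smul_apply,
    smul_eq_mul]
  exact Finset.sum_congr rfl fun j _ => by rw [wildBox_fderiv_apply_component hφ]

/-- The divergence in coordinates: `div φ (x) = Σᵢ ∂ᵢφᵢ(x)`. [folklore] -/
theorem wildBox_divergence_eq_sum {φ : Ed (Fin 3) → Ed (Fin 3)} {x : Ed (Fin 3)}
    (hφ : DifferentiableAt ℝ φ x) :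
    VectorCalculus.divergence φ x = ∑ i, pd (eb i) (fun y => φ y i) x := by
  rw [divergence_eq_sum_inner_fderiv (EuclideanSpace.basisFun (Fin 3) ℝ)]
  refine Finset.sum_congr rfl fun i _ => ?_
  rw [EuclideanSpace.basisFun_apply, EuclideanSpace.inner_single_left, map_one, one_mul]
  exact wildBox_fderiv_apply_component hφ (eb i) i

/-- **The pointwise Euler identity on `𝒦`.** If `u = v ⊗ v − (|v|²/3) Id` then for every linear
map `A` (the velocity gradient of a test field, `∂ⱼφᵢ = (A eⱼ)ᵢ`) and every scalar `q`,
`⟪v, A v⟫ + (q − |v|²/3)·tr A = Σᵢⱼ (uᵢⱼ + q δᵢⱼ) (A eⱼ)ᵢ`. [cite: ChoffrutSzekelyhidi2014, Lemma 2] -/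
theorem wildBox_pointwise_euler {w : State (Fin 3)} (hw : w ∈ K (‖vel w‖ ^ 2))
    {φ : Ed (Fin 3) → Ed (Fin 3)} {x : Ed (Fin 3)} (hφ : DifferentiableAt ℝ φ x) (q : ℝ) :
    ⟪vel w, fderiv ℝ φ x (vel w)⟫_ℝ + (q - ‖vel w‖ ^ 2 / 3) * VectorCalculus.divergence φ x =
      ∑ i, ∑ j, (str w i j + (if i = j then q else 0)) * pd (eb j) (fun y => φ y i) x := by
  obtain ⟨-, hstr⟩ := hw
  have hstr' : ∀ i j, str w i j = vel w i * vel w j - (if i = j then ‖vel w‖ ^ 2 / 3 else 0) := by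
    intro i j
    have hij := congrFun (congrFun hstr i) j
    simp only [Matrix.sub_apply, Matrix.smul_apply, Matrix.one_apply, smul_eq_mul, mul_ite, mul_one,
      mul_zero, Fintype.card_fin, Nat.cast_ofNat, tensorSelf, Matrix.vecMulVec_apply] at hij
    exact hij
  have hinner : ⟪vel w, fderiv ℝ φ x (vel w)⟫_ℝ = ∑ i, vel w i * ∑ j, vel w j * pd (eb j) (fun y => φ y i) x := by
    rw [PiLp.inner_apply]
    refine Finset.sum_congr rfl fun i _ => ?_
    rw [wildBox_fderiv_apply_eq_sum hφ]
    simp [mul_comm]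
  rw [hinner, wildBox_divergence_eq_sum hφ, Finset.mul_sum, ← Finset.sum_add_distrib]
  refine Finset.sum_congr rfl fun i _ => ?_
  have hsplit : ∀ j, (str w i j + (if i = j then q else 0)) * pd (eb j) (fun y => φ y i) x =
      vel w i * (vel w j * pd (eb j) (fun y => φ y i) x) +
        (if i = j then (q - ‖vel w‖ ^ 2 / 3) * pd (eb j) (fun y => φ y i) x else 0) := by
    intro j
    rw [hstr' i j]
    split_ifs <;> ring
  simp_rw [hsplit]
  rw [Finset.sum_add_distrib, Finset.sum_ite_eq, if_pos (Finset.mem_univ _), Finset.mul_sum]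


/-- Registered tools sub-stub `stub_wildBoxAssemblyTools` (integrability off the box, the norm
bound `‖x + 3e₀‖ ≥ 3` on the box, `mkSt 0 0 = 0`, and the pointwise Euler identity on `𝒦`). [folklore] -/
theorem stub_wildBoxAssemblyTools :
    ((∀ (F : Type) [NormedAddCommGroup F] (f : Ed (Fin 3) → F) (C : ℝ), AEStronglyMeasurable f volume → (∀ x, ‖f x‖ ≤ C) → (∀ x, x ∉ box (Fin 3) → f x = 0) → Integrable f) ∧ (∀ x : Ed (Fin 3), x ∈ box (Fin 3) → 3 ≤ ‖x + (3 : ℝ) • eb (0 : Fin 3)‖) ∧ ((mkSt (0 : Ed (Fin 3)) 0 : State (Fin 3)) = 0) ∧ (∀ (w : State (Fin 3)), w ∈ K (‖vel w‖ ^ 2) → ∀ (φ : Ed (Fin 3) → Ed (Fin 3)) (x : Ed (Fin 3)), DifferentiableAt ℝ φ x → ∀ q : ℝ, ⟪vel w, fderiv ℝ φ x (vel w)⟫_ℝ + (q - ‖vel w‖ ^ 2 / 3) * VectorCalculus.divergence φ x = ∑ i, ∑ j, (str w i j + (if i = j then q else 0)) * pd (eb j) (fun y => φ y i) x)) :=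
  ⟨fun _ _ _ _ hf hC h0 => wildBox_integrable_of_bdd hf hC h0, fun _ hx => wildBox_three_le_norm_add hx,
    wildBox_mkSt_zero, fun _ hw _ _ hφ q => wildBox_pointwise_euler hw hφ q⟩

end Summit.AnomalousDissipation.AnomalousDissipation.Theorems

end
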